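import Summits.BirchSwinnertonDyer.Rank1Residual.AdditivePotMult.QuadraticTwistTamagawaTypeIVFlip
import Literature.NumberTheory.EllipticCurves.QuadraticTwistMinimalModelProofs
import HarnessLib

/-!
# The type-`IV` / `IV*` Tamagawa FLIP over a residue field of two elements (row T-MIL-B2, B2-1)

HONEST FRAMING (cell `b2b-bsdres`, run/shared/lean/b2b/bsd-rank1-residual/, verbatim in every
file): the goal of the cell is to DELETE the COMBINATION-SHAPED residual classes of the
Birch–Swinnerton-Dyer formula for ALL analytic-rank `≤ 1` elliptic curves over `ℚ` — "full BSD
formula for every rank `≤ 1` curve in class `C`" assembled STRICTLY from published theorems — so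
that the rank-`≤ 1` remainder becomes exactly the CONSTRUCTION-SHAPED classes, which are TYPED
(missing-input `Prop`s), NOT attempted. This is not "finishing BSD". Sub-classes X3♯(M) / X4(M)
(additive, base-change-and-descend): a RESEARCH ROUTE; they stay CONSTRUCTION-SHAPED; nothing is
booked by this file; no mark / label moved. THEOREMS ONLY: no definition, no named fact, no `sorry`.
This is the `ℓ = 2` case that row T-MIL-B (n1011-p08, `QuadraticTwistTamagawaTypeIVFlip`) declared
OUT ("the flip at an inert `ℓ = 2` needs the `twistModel` / Artin–Schreier argument").

At an inert place `ℓ = 2` (residue field `𝔽₂`; `K = ℚ(√d)`, `d ≡ 5 (mod 8)`, e.g. `d = −3`) of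
Kodaira type `IV` / `IV*` the unit twist is given by the tree's integral twist model
`WeierstrassCurve.twistModel k` (`d = 4k + 1`).  For a `IV` normal form `J` (`a₃ = ϖγ`,
`a₆ = ϖ²ε`, `γ̄ ≠ 0`) the twist model is again a `IV` normal form with `γ' = dγ`,
`ε' = d³ε + k d²γ²`; over `𝔽₂` (`d̄ = 1`, `k̄ = 1` for `d ≡ 5 mod 8`, `γ̄ = 1`) the Step-5
quadratics are `Y² + Y + ε̄` and `Y² + Y + (ε̄ + 1)`: exactly one has a root (Artin–Schreier), so
`{c(W), c(W^{(d)})} = {1, 3}` and `v₃(c(W)) + v₃(c(W^{(d)})) = 1`.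
-/

noncomputable section

open scoped Classical

open WeierstrassCurve IsLocalRing Polynomial
  Literature.NumberTheory.EllipticCurves Literature.NumberTheory.EllipticCurves.LocalIndex
  Literature.NumberTheory.DiophantineGeometry.TateAlgorithm

namespace Summit.BirchSwinnertonDyer.Rank1Residual.AdditivePotMult

namespace TypeIVTwistTwo

section DVR

variable {R : Type*} [CommRing R] [IsDomain R] [IsDiscreteValuationRing R]
  {K : Type*} [Field K] [Algebra R K] [IsFractionRing R K]

/-- **The (Connell) twist model `J.twistModel k` of a type-`IV` normal form is a type-`IV` normal
form** with `γ' = (4k+1)γ`, `ε' = (4k+1)³ε + k(4k+1)²γ²`. [folklore] -/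
theorem normalForm_IV_twistModel (J : WeierstrassCurve R) (h1 : J.a₁ ∈ maximalIdeal R)
    (h2 : J.a₂ ∈ maximalIdeal R) {ϖ γ ε : R} (hϖ : Irreducible ϖ) (hγ : J.a₃ = ϖ * γ)
    (h4 : J.a₄ ∈ maximalIdeal R ^ 2) (hε : J.a₆ = ϖ ^ 2 * ε) (k : R) :
    (J.twistModel k).a₁ ∈ maximalIdeal R ∧ (J.twistModel k).a₂ ∈ maximalIdeal R ∧
      (J.twistModel k).a₃ = ϖ * ((4 * k + 1) * γ) ∧ (J.twistModel k).a₄ ∈ maximalIdeal R ^ 2 ∧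
      (J.twistModel k).a₆ = ϖ ^ 2 * ((4 * k + 1) ^ 3 * ε + k * (4 * k + 1) ^ 2 * γ ^ 2) := by
  have hm : ϖ ∈ maximalIdeal R := (IsLocalRing.mem_maximalIdeal _).mpr hϖ.not_isUnit
  have h3 : J.a₃ ∈ maximalIdeal R := hγ ▸ Ideal.mul_mem_right _ _ hm
  refine ⟨by simpa using h1, ?_, ?_, ?_, ?_⟩
  · rw [twistModel_a₂]
    exact Ideal.add_mem _ (Ideal.mul_mem_left _ _ h2)
      (by rw [sq]; exact Ideal.mul_mem_left _ _ (Ideal.mul_mem_left _ _ h1))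
  · rw [twistModel_a₃, hγ]; ring
  · rw [twistModel_a₄]
    refine Ideal.add_mem _ (Ideal.mul_mem_left _ _ h4) ?_
    have : (2 * k * (4 * k + 1)) * (J.a₁ * J.a₃) ∈ maximalIdeal R ^ 2 := by
      rw [sq]; exact Ideal.mul_mem_left _ _ (Ideal.mul_mem_mul h1 h3)
    simpa [mul_assoc] using this
  · rw [twistModel_a₆, hγ, hε]; ring

/-- **The twist model of a type-`IV*` normal form is a type-`IV*` normal form** with
`γ' = (4k+1)γ`, `ε' = (4k+1)³ε + k(4k+1)²γ²`. [folklore] -/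
theorem normalForm_IVstar_twistModel (J : WeierstrassCurve R) (h1 : J.a₁ ∈ maximalIdeal R)
    (h2 : J.a₂ ∈ maximalIdeal R ^ 2) {ϖ γ ε : R} (hϖ : Irreducible ϖ) (hγ : J.a₃ = ϖ ^ 2 * γ)
    (h4 : J.a₄ ∈ maximalIdeal R ^ 3) (hε : J.a₆ = ϖ ^ 4 * ε) (k : R) :
    (J.twistModel k).a₁ ∈ maximalIdeal R ∧ (J.twistModel k).a₂ ∈ maximalIdeal R ^ 2 ∧
      (J.twistModel k).a₃ = ϖ ^ 2 * ((4 * k + 1) * γ) ∧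
      (J.twistModel k).a₄ ∈ maximalIdeal R ^ 3 ∧
      (J.twistModel k).a₆ = ϖ ^ 4 * ((4 * k + 1) ^ 3 * ε + k * (4 * k + 1) ^ 2 * γ ^ 2) := by
  have hm : ϖ ∈ maximalIdeal R := (IsLocalRing.mem_maximalIdeal _).mpr hϖ.not_isUnit
  have h3 : J.a₃ ∈ maximalIdeal R ^ 2 := hγ ▸ Ideal.mul_mem_right _ _ (Ideal.pow_mem_pow hm 2)
  refine ⟨by simpa using h1, ?_, ?_, ?_, ?_⟩
  · rw [twistModel_a₂]
    refine Ideal.add_mem _ (Ideal.mul_mem_left _ _ h2) ?_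
    rw [sq, sq]; exact Ideal.mul_mem_left _ _ (Ideal.mul_mem_mul h1 h1)
  · rw [twistModel_a₃, hγ]; ring
  · rw [twistModel_a₄]
    refine Ideal.add_mem _ (Ideal.mul_mem_left _ _ h4) ?_
    have : (2 * k * (4 * k + 1)) * (J.a₁ * J.a₃) ∈ maximalIdeal R ^ 3 := by
      rw [show maximalIdeal R ^ 3 = maximalIdeal R * maximalIdeal R ^ 2 from pow_succ' _ 2]
      exact Ideal.mul_mem_left _ _ (Ideal.mul_mem_mul h1 h3)
    simpa [mul_assoc] using this
  · rw [twistModel_a₆, hγ, hε]; ring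

/-- The discriminants of the two Step-5/8 quadratics: with `γ' = dγ`, `ε' = d³ε + kd²γ²`
(`d = 4k+1`), `γ̄'² + 4ε̄' = d̄³ (γ̄² + 4ε̄)`. [folklore] -/
theorem disc_twistModel_eq (k γ ε : R) :
    residue R ((4 * k + 1) * γ) ^ 2 +
        4 * residue R ((4 * k + 1) ^ 3 * ε + k * (4 * k + 1) ^ 2 * γ ^ 2) =
      residue R (4 * k + 1) ^ 3 * (residue R γ ^ 2 + 4 * residue R ε) := by
  simp only [map_mul, map_pow, map_add, map_ofNat, map_one]
  ring

/-- In a field with two elements every element is `0` or `1`. [folklore] -/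
theorem eq_zero_or_eq_one_of_card_eq_two {F : Type*} [Field F] [Finite F]
    (hF : Nat.card F = 2) (x : F) : x = 0 ∨ x = 1 := by
  classical
  by_contra h
  push Not at h
  haveI := Fintype.ofFinite F
  have hcard : ({0, 1, x} : Finset F).card = 3 := by
    rw [Finset.card_insert_of_notMem, Finset.card_insert_of_notMem, Finset.card_singleton]
    · simpa using h.2.symm
    · simp [h.1.symm]
  have hle := Finset.card_le_univ ({0, 1, x} : Finset F)
  rw [hcard, ← Nat.card_eq_fintype_card, hF] at hle
  omega

/-- Over a residue field with TWO elements (`ℓ = 2` over `ℚ`): for `k` a unit (`d = 4k + 1`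
non-square in `ℤ₂`, i.e. `d ≡ 5 mod 8`) and a separable Step-5/8 quadratic (`γ̄² + 4ε̄ ≠ 0`, i.e.
`γ̄ = 1`), the twisted quadratic `Y² + γ̄'Y − ε̄'` (`γ' = dγ`, `ε' = d³ε + kd²γ²`) has a root iff
the original `Y² + γ̄Y − ε̄` has NONE — Artin–Schreier: the two constant terms differ by
`k̄γ̄² = 1`. [folklore] -/
theorem exists_root_twistModel_iff_not_of_card_two [Finite (ResidueField R)]
    (hcard : Nat.card (ResidueField R) = 2) {k : R} (hk : IsUnit k) {γ ε : R}
    (hdisc : residue R γ ^ 2 + 4 * residue R ε ≠ 0) :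
    (∃ r : ResidueField R, r ^ 2 + residue R ((4 * k + 1) * γ) * r
        - residue R ((4 * k + 1) ^ 3 * ε + k * (4 * k + 1) ^ 2 * γ ^ 2) = 0) ↔
      ¬ ∃ r : ResidueField R, r ^ 2 + residue R γ * r - residue R ε = 0 := by
  have h01 := eq_zero_or_eq_one_of_card_eq_two hcard
  have h2 : (2 : ResidueField R) = 0 := by
    rcases h01 2 with h | h
    · exact h
    · exfalso; exact one_ne_zero (by linear_combination h)
  have hsq : ∀ r : ResidueField R, r ^ 2 + r = 0 := fun r ↦ by
    rcases h01 r with rfl | rfl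
    · ring
    · linear_combination h2
  have hk1 : residue R k = 1 := by
    rcases h01 (residue R k) with h | h
    · exact absurd h ((residue_ne_zero_iff_isUnit k).mpr hk)
    · exact h
  have hγ1 : residue R γ = 1 := by
    rcases h01 (residue R γ) with h | h
    · exfalso; apply hdisc; rw [h, show (4 : ResidueField R) = 2 * 2 by norm_num, h2]; ring
    · exact h
  have hd1 : residue R (4 * k + 1) = 1 := by
    rw [map_add, map_mul, map_ofNat, map_one, show (4 : ResidueField R) = 2 * 2 by norm_num, h2]
    ring
  have hε' : residue R ((4 * k + 1) ^ 3 * ε + k * (4 * k + 1) ^ 2 * γ ^ 2) = residue R ε + 1 := by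
    rw [map_add, map_mul, map_mul, map_mul, map_pow, map_pow, map_pow, hd1, hk1, hγ1]; ring
  have hγ' : residue R ((4 * k + 1) * γ) = 1 := by rw [map_mul, hd1, hγ1, one_mul]
  rw [hε', hγ', hγ1]
  have hval : ∀ (c r : ResidueField R), r ^ 2 + 1 * r - c = -c := fun c r ↦ by
    linear_combination hsq r
  simp_rw [hval, neg_eq_zero, exists_const]
  constructor
  · intro h h0
    rw [h0, zero_add] at h
    exact one_ne_zero h
  · intro h
    rcases h01 (residue R ε) with h0 | h1'
    · exact absurd h0 h
    · rw [h1']; linear_combination h2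

/-- **THE FLIP at type `IV`, residue field `𝔽₂`** (the `ℓ = 2` case left out of row T-MIL-B): `R`
Henselian DVR with residue field of two elements, `W/K` elliptic with a MINIMAL `R`-model `J`
(`D • W = J ⊗ K`) in the type-`IV` normal form, `d = 4k + 1` with `k ∈ Rˣ` (i.e. `d` a
non-square unit, `K(√d)/K` the unramified quadratic extension), `W'/K` elliptic with
`D' • W' = J.twistModel k ⊗ K` minimal (e.g. `W' = W^{(d)}`, tree
`exists_variableChange_twistModel_eq_quadraticTwist` + `isMinimal…twistModel`). Then
`c(W'/K) = 3 ↔ c(W/K) = 1` (Silverman ATAEC IV.9.4 Step 5 in exact form, `…TypeIVExact`).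
[cite: SilvermanATAEC1994, IV.9.4 Step 5 (PDF p. 344)] [cite: SilvermanAEC2009, X.5 Cor. 5.4] -/
theorem localTamagawaNumber_twistModel_eq_three_iff_eq_one_of_normalForm_IV
    [HenselianLocalRing R] [Finite (ResidueField R)] (hcard : Nat.card (ResidueField R) = 2)
    (W : WeierstrassCurve K) [W.IsElliptic] (J : WeierstrassCurve R) (D : VariableChange K)
    (hJ : D • W = J.baseChange K) [(J.baseChange K).IsMinimal R]
    (h1 : J.a₁ ∈ maximalIdeal R) (ha₂ : J.a₂ ∈ maximalIdeal R) {ϖ γ ε : R} (hϖ : Irreducible ϖ)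
    (hγ : J.a₃ = ϖ * γ) (h4 : J.a₄ ∈ maximalIdeal R ^ 2) (hε : J.a₆ = ϖ ^ 2 * ε)
    (hdisc : residue R γ ^ 2 + 4 * residue R ε ≠ 0) {k : R} (hk : IsUnit k)
    (hd : IsUnit (4 * k + 1)) (W' : WeierstrassCurve K) [W'.IsElliptic] (D' : VariableChange K)
    (hJ' : D' • W' = (J.twistModel k).baseChange K) [((J.twistModel k).baseChange K).IsMinimal R] :
    W'.localTamagawaNumber R = 3 ↔ W.localTamagawaNumber R = 1 := by
  obtain ⟨h1', h2', hγ', h4', hε'⟩ := normalForm_IV_twistModel J h1 ha₂ hϖ hγ h4 hε k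
  have hdisc' : residue R ((4 * k + 1) * γ) ^ 2 +
      4 * residue R ((4 * k + 1) ^ 3 * ε + k * (4 * k + 1) ^ 2 * γ ^ 2) ≠ 0 := by
    rw [disc_twistModel_eq]
    exact mul_ne_zero (pow_ne_zero 3 ((residue_ne_zero_iff_isUnit _).mpr hd)) hdisc
  rw [localTamagawaNumber_eq_three_iff_exists_root_of_normalForm_IV W' (J.twistModel k) D' hJ'
      h1' h2' hϖ hγ' h4' hε' hdisc', exists_root_twistModel_iff_not_of_card_two hcard hk hdisc,
    localTamagawaNumber_eq_one_iff_forall_not_root_of_normalForm_IV W J D hJ h1 ha₂ hϖ hγ h4 hε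
      hdisc, not_exists]

/-- **`v₃(c(W)) + v₃(c(W')) = 1`** at type `IV`, residue field `𝔽₂`, `W'` the unramified
quadratic twist (`D' • W' = J.twistModel k ⊗ K`): both `c` lie in `{1, 3}` and exactly one is `3`.
[cite: SilvermanATAEC1994, IV.9.4 Step 5 (PDF p. 344)] -/
theorem padicValNat_localTamagawaNumber_add_twistModel_of_normalForm_IV
    [HenselianLocalRing R] [Finite (ResidueField R)] (hcard : Nat.card (ResidueField R) = 2)
    (W : WeierstrassCurve K) [W.IsElliptic] (J : WeierstrassCurve R) (D : VariableChange K)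
    (hJ : D • W = J.baseChange K) [(J.baseChange K).IsMinimal R]
    (h1 : J.a₁ ∈ maximalIdeal R) (ha₂ : J.a₂ ∈ maximalIdeal R) {ϖ γ ε : R} (hϖ : Irreducible ϖ)
    (hγ : J.a₃ = ϖ * γ) (h4 : J.a₄ ∈ maximalIdeal R ^ 2) (hε : J.a₆ = ϖ ^ 2 * ε)
    (hdisc : residue R γ ^ 2 + 4 * residue R ε ≠ 0) {k : R} (hk : IsUnit k)
    (hd : IsUnit (4 * k + 1)) (W' : WeierstrassCurve K) [W'.IsElliptic] (D' : VariableChange K)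
    (hJ' : D' • W' = (J.twistModel k).baseChange K) [((J.twistModel k).baseChange K).IsMinimal R] :
    padicValNat 3 (W.localTamagawaNumber R) + padicValNat 3 (W'.localTamagawaNumber R) = 1 := by
  have hflip := localTamagawaNumber_twistModel_eq_three_iff_eq_one_of_normalForm_IV hcard W J D hJ
    h1 ha₂ hϖ hγ h4 hε hdisc hk hd W' D' hJ'
  obtain ⟨h1', h2', hγ', h4', hε'⟩ := normalForm_IV_twistModel J h1 ha₂ hϖ hγ h4 hε k
  have hdisc' : residue R ((4 * k + 1) * γ) ^ 2 +
      4 * residue R ((4 * k + 1) ^ 3 * ε + k * (4 * k + 1) ^ 2 * γ ^ 2) ≠ 0 := by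
    rw [disc_twistModel_eq]
    exact mul_ne_zero (pow_ne_zero 3 ((residue_ne_zero_iff_isUnit _).mpr hd)) hdisc
  have hΔ : J.Δ ≠ 0 := by
    intro h0
    have : (J.baseChange K).Δ = 0 := by
      simp only [WeierstrassCurve.baseChange, WeierstrassCurve.map_Δ, h0, map_zero]
    rw [← hJ, WeierstrassCurve.variableChange_Δ] at this
    exact mul_ne_zero (pow_ne_zero _ (Units.ne_zero _)) (W.coe_Δ' ▸ W.Δ'.ne_zero) this
  have hΔ' : (J.twistModel k).Δ ≠ 0 := by
    intro h0
    have : ((J.twistModel k).baseChange K).Δ = 0 := by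
      simp only [WeierstrassCurve.baseChange, WeierstrassCurve.map_Δ, h0, map_zero]
    rw [← hJ', WeierstrassCurve.variableChange_Δ] at this
    exact mul_ne_zero (pow_ne_zero _ (Units.ne_zero _)) (W'.coe_Δ' ▸ W'.Δ'.ne_zero) this
  have hWmem : W.localTamagawaNumber R = 1 ∨ W.localTamagawaNumber R = 3 := by
    rw [localTamagawaNumber_eq_index_of_smul_eq_baseChange W J D hJ]
    by_cases hr : ∃ r : ResidueField R, r ^ 2 + residue R γ * r - residue R ε = 0
    · exact Or.inr ((index_eq_three_iff_exists_root_of_normalForm_IV J h1 ha₂ hϖ hγ h4 hε hdisc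
        hΔ).mpr hr)
    · rw [not_exists] at hr
      exact Or.inl (index_eq_one_of_forall_not_root_of_normalForm_IV J h1 ha₂ hϖ hγ h4 hε hr)
  have hW'mem : W'.localTamagawaNumber R = 1 ∨ W'.localTamagawaNumber R = 3 := by
    rw [localTamagawaNumber_eq_index_of_smul_eq_baseChange W' (J.twistModel k) D' hJ']
    by_cases hr : ∃ r : ResidueField R, r ^ 2 + residue R ((4 * k + 1) * γ) * r
        - residue R ((4 * k + 1) ^ 3 * ε + k * (4 * k + 1) ^ 2 * γ ^ 2) = 0
    · exact Or.inr ((index_eq_three_iff_exists_root_of_normalForm_IV (J.twistModel k) h1' h2' hϖ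
        hγ' h4' hε' hdisc' hΔ').mpr hr)
    · rw [not_exists] at hr
      exact Or.inl (index_eq_one_of_forall_not_root_of_normalForm_IV (J.twistModel k) h1' h2' hϖ
        hγ' h4' hε' hr)
  rcases hWmem with hW | hW <;> rcases hW'mem with hW' | hW'
  · exact absurd (hflip.mpr hW) (by rw [hW']; norm_num)
  · rw [hW, hW']; simp
  · rw [hW, hW']; simp
  · exact absurd (hflip.mp hW') (by rw [hW]; norm_num)

/-- **THE FLIP at type `IV*`, residue field `𝔽₂`** (the `ℓ = 2` case left out of row T-MIL-B): `R`
Henselian DVR with residue field of two elements, `W/K` elliptic with a MINIMAL `R`-model `J`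
(`D • W = J ⊗ K`) in the type-`IV*` normal form (`a₁ ∈ 𝔪`, `a₂ ∈ 𝔪²`, `a₃ = ϖ²γ`, `a₄ ∈ 𝔪³`, `a₆ = ϖ⁴ε`), `d = 4k + 1` with `k ∈ Rˣ` (i.e. `d` a
non-square unit, `K(√d)/K` the unramified quadratic extension), `W'/K` elliptic with
`D' • W' = J.twistModel k ⊗ K` minimal (e.g. `W' = W^{(d)}`, tree
`exists_variableChange_twistModel_eq_quadraticTwist` + `isMinimal…twistModel`). Then
`c(W'/K) = 3 ↔ c(W/K) = 1` (Silverman ATAEC IV.9.4 Step 8 in exact form, `…TypeIVstarExact`).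
[cite: SilvermanATAEC1994, IV.9.4 Step 8 (PDF p. 346)] [cite: SilvermanAEC2009, X.5 Cor. 5.4] -/
theorem localTamagawaNumber_twistModel_eq_three_iff_eq_one_of_normalForm_IVstar
    [HenselianLocalRing R] [Finite (ResidueField R)] (hcard : Nat.card (ResidueField R) = 2)
    (W : WeierstrassCurve K) [W.IsElliptic] (J : WeierstrassCurve R) (D : VariableChange K)
    (hJ : D • W = J.baseChange K) [(J.baseChange K).IsMinimal R]
    (h1 : J.a₁ ∈ maximalIdeal R) (ha₂ : J.a₂ ∈ maximalIdeal R ^ 2) {ϖ γ ε : R} (hϖ : Irreducible ϖ)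
    (hγ : J.a₃ = ϖ ^ 2 * γ) (h4 : J.a₄ ∈ maximalIdeal R ^ 3) (hε : J.a₆ = ϖ ^ 4 * ε)
    (hdisc : residue R γ ^ 2 + 4 * residue R ε ≠ 0) {k : R} (hk : IsUnit k)
    (hd : IsUnit (4 * k + 1)) (W' : WeierstrassCurve K) [W'.IsElliptic] (D' : VariableChange K)
    (hJ' : D' • W' = (J.twistModel k).baseChange K) [((J.twistModel k).baseChange K).IsMinimal R] :
    W'.localTamagawaNumber R = 3 ↔ W.localTamagawaNumber R = 1 := by
  obtain ⟨h1', h2', hγ', h4', hε'⟩ := normalForm_IVstar_twistModel J h1 ha₂ hϖ hγ h4 hε k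
  have hdisc' : residue R ((4 * k + 1) * γ) ^ 2 +
      4 * residue R ((4 * k + 1) ^ 3 * ε + k * (4 * k + 1) ^ 2 * γ ^ 2) ≠ 0 := by
    rw [disc_twistModel_eq]
    exact mul_ne_zero (pow_ne_zero 3 ((residue_ne_zero_iff_isUnit _).mpr hd)) hdisc
  rw [localTamagawaNumber_eq_three_iff_exists_root_of_normalForm_IVstar W' (J.twistModel k) D' hJ'
      h1' h2' hϖ hγ' h4' hε' hdisc', exists_root_twistModel_iff_not_of_card_two hcard hk hdisc,
    localTamagawaNumber_eq_one_iff_forall_not_root_of_normalForm_IVstar W J D hJ h1 ha₂ hϖ hγ h4 hε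
      hdisc, not_exists]

/-- **`v₃(c(W)) + v₃(c(W')) = 1`** at type `IV*`, residue field `𝔽₂`, `W'` the unramified
quadratic twist (`D' • W' = J.twistModel k ⊗ K`): both `c` lie in `{1, 3}` and exactly one is `3`.
[cite: SilvermanATAEC1994, IV.9.4 Step 8 (PDF p. 346)] -/
theorem padicValNat_localTamagawaNumber_add_twistModel_of_normalForm_IVstar
    [HenselianLocalRing R] [Finite (ResidueField R)] (hcard : Nat.card (ResidueField R) = 2)
    (W : WeierstrassCurve K) [W.IsElliptic] (J : WeierstrassCurve R) (D : VariableChange K)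
    (hJ : D • W = J.baseChange K) [(J.baseChange K).IsMinimal R]
    (h1 : J.a₁ ∈ maximalIdeal R) (ha₂ : J.a₂ ∈ maximalIdeal R ^ 2) {ϖ γ ε : R} (hϖ : Irreducible ϖ)
    (hγ : J.a₃ = ϖ ^ 2 * γ) (h4 : J.a₄ ∈ maximalIdeal R ^ 3) (hε : J.a₆ = ϖ ^ 4 * ε)
    (hdisc : residue R γ ^ 2 + 4 * residue R ε ≠ 0) {k : R} (hk : IsUnit k)
    (hd : IsUnit (4 * k + 1)) (W' : WeierstrassCurve K) [W'.IsElliptic] (D' : VariableChange K)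
    (hJ' : D' • W' = (J.twistModel k).baseChange K) [((J.twistModel k).baseChange K).IsMinimal R] :
    padicValNat 3 (W.localTamagawaNumber R) + padicValNat 3 (W'.localTamagawaNumber R) = 1 := by
  have hflip := localTamagawaNumber_twistModel_eq_three_iff_eq_one_of_normalForm_IVstar hcard W J D hJ
    h1 ha₂ hϖ hγ h4 hε hdisc hk hd W' D' hJ'
  obtain ⟨h1', h2', hγ', h4', hε'⟩ := normalForm_IVstar_twistModel J h1 ha₂ hϖ hγ h4 hε k
  have hdisc' : residue R ((4 * k + 1) * γ) ^ 2 +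
      4 * residue R ((4 * k + 1) ^ 3 * ε + k * (4 * k + 1) ^ 2 * γ ^ 2) ≠ 0 := by
    rw [disc_twistModel_eq]
    exact mul_ne_zero (pow_ne_zero 3 ((residue_ne_zero_iff_isUnit _).mpr hd)) hdisc
  have hΔ : J.Δ ≠ 0 := by
    intro h0
    have : (J.baseChange K).Δ = 0 := by
      simp only [WeierstrassCurve.baseChange, WeierstrassCurve.map_Δ, h0, map_zero]
    rw [← hJ, WeierstrassCurve.variableChange_Δ] at this
    exact mul_ne_zero (pow_ne_zero _ (Units.ne_zero _)) (W.coe_Δ' ▸ W.Δ'.ne_zero) this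
  have hΔ' : (J.twistModel k).Δ ≠ 0 := by
    intro h0
    have : ((J.twistModel k).baseChange K).Δ = 0 := by
      simp only [WeierstrassCurve.baseChange, WeierstrassCurve.map_Δ, h0, map_zero]
    rw [← hJ', WeierstrassCurve.variableChange_Δ] at this
    exact mul_ne_zero (pow_ne_zero _ (Units.ne_zero _)) (W'.coe_Δ' ▸ W'.Δ'.ne_zero) this
  have hWmem : W.localTamagawaNumber R = 1 ∨ W.localTamagawaNumber R = 3 := by
    rw [localTamagawaNumber_eq_index_of_smul_eq_baseChange W J D hJ]
    by_cases hr : ∃ r : ResidueField R, r ^ 2 + residue R γ * r - residue R ε = 0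
    · exact Or.inr ((index_eq_three_iff_exists_root_of_normalForm_IVstar J h1 ha₂ hϖ hγ h4 hε hdisc
        hΔ).mpr hr)
    · rw [not_exists] at hr
      exact Or.inl (index_eq_one_of_forall_not_root_of_normalForm_IVstar J h1 ha₂ hϖ hγ h4 hε hr)
  have hW'mem : W'.localTamagawaNumber R = 1 ∨ W'.localTamagawaNumber R = 3 := by
    rw [localTamagawaNumber_eq_index_of_smul_eq_baseChange W' (J.twistModel k) D' hJ']
    by_cases hr : ∃ r : ResidueField R, r ^ 2 + residue R ((4 * k + 1) * γ) * r
        - residue R ((4 * k + 1) ^ 3 * ε + k * (4 * k + 1) ^ 2 * γ ^ 2) = 0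
    · exact Or.inr ((index_eq_three_iff_exists_root_of_normalForm_IVstar (J.twistModel k) h1' h2' hϖ
        hγ' h4' hε' hdisc' hΔ').mpr hr)
    · rw [not_exists] at hr
      exact Or.inl (index_eq_one_of_forall_not_root_of_normalForm_IVstar (J.twistModel k) h1' h2' hϖ
        hγ' h4' hε' hr)
  rcases hWmem with hW | hW <;> rcases hW'mem with hW' | hW'
  · exact absurd (hflip.mpr hW) (by rw [hW']; norm_num)
  · rw [hW, hW']; simp
  · rw [hW, hW']; simp
  · exact absurd (hflip.mp hW') (by rw [hW]; norm_num)

end DVR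

end TypeIVTwistTwo

end Summit.BirchSwinnertonDyer.Rank1Residual.AdditivePotMult

end
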